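import Literature.NumberTheory.ModularSymbols.FullLevelHomologyCuspidalClass
import Literature.NumberTheory.ModularSymbols.FullLevelHomologyHeckeChain
import HarnessLib

/-!
# Coset classes in `H₁(Γ₀(M), k[GL₂(ℤ/p)])^{T̃}`: their images under the up/down dictionary and under `T_q`

Topic `Literature/NumberTheory/ModularSymbols`; namespace `Literature.NumberTheory.ModularSymbols.FullLevel`; sequel of
`FullLevelHomologyCuspidalClass` (`torusInvariantsToCuspidal`) and `FullLevelHomologyHeckeChain` (`heckeChain`, `heckeT`).
Definitions with bodies + proved theorems; no named fact, no `sorry`, no instance, no notation.  First half of the comparison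
«`T_q` upstairs ↔ `T_q` on `H(p²M; k)`» (memo CARRIER-gen1 §6 (3)); the second half (instantiating
`CuspidalHomologyHeckeRepIndependence` at level `p²M`) is NOT here.

* `liftCosetChain` (a `k[G/T̃]`-chain lifted coefficientwise by `δ_{xT̃} ↦ 1_{xT̃}`; cycles to cycles), `H1lift_H1π`;
  **`cosetClass c := (averaging iso)⁻¹ [c] ∈ H₁(Γ₀(M), k[GL₂(ℤ/p)])^{T̃}`** for a cycle `c` with coefficients in `k[G/T̃]`,
  `coe_cosetClass` (`= ⅟|T̃|·[liftCosetChain c]`), `exists_cosetClass_eq` (every invariant class is one).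
* **`torusInvariantsEquiv_cosetClass_of_eq`**: if `componentMap [w] = [c]` (`w ∈ H₁(Γ_T, k)`, e.g. given by the explicit
  transfer `symbolPart`), then the dictionary sends `cosetClass c` to `w`; `torusLevelH1Iso_single` (`[γ ⊗ a] ↦ [δ⁻¹γδ ⊗ a]`);
  **`torusInvariantsToCuspidal_cosetClass_of_eq_single`**: `cosetClass c ↦ a · ({∞, (δ⁻¹γδ)∞} ⊗ 1) ∈ H(p²M; k)` when
  `[c] = componentMap [γ ⊗ a]`.
* `coeffAct_cosetIndicator`, `coeffAct_cosetLiftHom` (left translation by ANY `g ∈ GL₂(ℤ/p)` commutes with the coset lift),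
  `heckeChainQuot` (the Hecke operator on `k[G/T̃]`-chains, `[γ] ⊗ f ↦ Σᵢ [γ'ᵢ] ⊗ β̄ᵢ⋆f`) and
  **`heckeChain_liftCosetChain`**: `T_q(lift c) = lift(T_q^{quot} c)`.

## References
* K. S. Brown, *Cohomology of Groups* (1982), Ch. III §5–§6. [Brown1982]
* G. Shimura, *Introduction to the arithmetic theory of automorphic functions* (1971), §8.3 (8.3.2). [Shimura1971]
* A. Ash, G. Stevens, Duke Math. J. 53 (1986), §1 (1.2)–(1.4). [AshStevens1986]
* F. Diamond, J. Shurman, *A First Course in Modular Forms* (2005), §1.5. [DiamondShurman2005]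
-/

noncomputable section

namespace Literature.NumberTheory.ModularSymbols

namespace FullLevel

open scoped MatrixGroups TensorProduct
open CategoryTheory CongruenceSubgroup groupHomology Finsupp Matrix
open Literature.Algebra.Homology
open Literature.NumberTheory.EllipticCurves.ModularForms

variable (k : Type) [CommRing k] (p M : ℕ) [Fact p.Prime]

/-! ### Coset-supported cycles `Σᵢ [γᵢ] ⊗ aᵢ·1_{xᵢT̃}` and their image under the up/down dictionary -/

/-- A `1`-chain with coefficients in `k[G/T̃]` lifted to `k[G]` coefficientwise by the coset indicator
`δ_{xT̃} ↦ 1_{xT̃} = Σ_{t ∈ T̃} δ_{xt}` (`PermutationCoeff.cosetLiftHom`). [cite: Brown1982, Ch. III §5] -/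
def liftCosetChain [Fintype (diagTorus (ZMod p))]
    (c : Gamma0 M →₀ PermutationCoeff.permRepObj k (redGL p M) (GL (Fin 2) (ZMod p) ⧸ diagTorus (ZMod p))) :
    Gamma0 M →₀ coeff k p M :=
  mapRange.linearMap (PermutationCoeff.cosetLiftHom (k := k) (redGL p M) (diagTorus (ZMod p))).hom.toLinearMap c

/-- The coset lift of a cycle is a cycle (it is the chain map of a morphism of representations). [cite: Brown1982, Ch. III §5] -/
theorem liftCosetChain_mem_cycles₁ [Fintype (diagTorus (ZMod p))]
    (c : cycles₁ (PermutationCoeff.permRepObj k (redGL p M) (GL (Fin 2) (ZMod p) ⧸ diagTorus (ZMod p)))) :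
    liftCosetChain k p M c.1 ∈ cycles₁ (coeff k p M) := by
  have h := (mapCycles₁ (A := PermutationCoeff.permRepObj k (redGL p M) (GL (Fin 2) (ZMod p) ⧸ diagTorus (ZMod p)))
    (B := coeff k p M) (MonoidHom.id _) (PermutationCoeff.cosetLiftHom (k := k) (redGL p M) (diagTorus (ZMod p))) c).2
  have e : (mapCycles₁ (A := PermutationCoeff.permRepObj k (redGL p M) (GL (Fin 2) (ZMod p) ⧸ diagTorus (ZMod p)))
      (B := coeff k p M) (MonoidHom.id _) (PermutationCoeff.cosetLiftHom (k := k) (redGL p M) (diagTorus (ZMod p))) c).1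
      = liftCosetChain k p M c.1 := by
    rw [coe_mapCycles₁]
    unfold liftCosetChain
    simp only [ModuleCat.hom_ofHom, LinearMap.coe_comp, Function.comp_apply, lmapDomain_apply, MonoidHom.coe_id,
      mapDomain_id]
  rw [e] at h
  exact h

/-- `H₁(σ')[c] = [liftCosetChain c]` (`PermutationCoeff.H1lift` on classes). [cite: Brown1982, Ch. III §6] -/
theorem H1lift_H1π [Fintype (diagTorus (ZMod p))]
    (c : cycles₁ (PermutationCoeff.permRepObj k (redGL p M) (GL (Fin 2) (ZMod p) ⧸ diagTorus (ZMod p)))) :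
    PermutationCoeff.H1lift k (redGL p M) (diagTorus (ZMod p)) (H1π _ c) =
      H1π (coeff k p M) ⟨liftCosetChain k p M c.1, liftCosetChain_mem_cycles₁ k p M c⟩ := by
  rw [PermutationCoeff.H1lift, groupHomology.H1π_comp_map_apply
    (A := PermutationCoeff.permRepObj k (redGL p M) (GL (Fin 2) (ZMod p) ⧸ diagTorus (ZMod p))) (B := coeff k p M)]
  congr 1
  apply Subtype.ext
  rw [coe_mapCycles₁]
  unfold liftCosetChain
  simp only [ModuleCat.hom_ofHom, LinearMap.coe_comp, Function.comp_apply, lmapDomain_apply, MonoidHom.coe_id,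
    mapDomain_id]

variable [Fintype (diagTorus (ZMod p))] [Invertible (Fintype.card (diagTorus (ZMod p)) : k)]

/-- The `T̃`-invariant class `⅟|T̃| · [liftCosetChain c]` attached to a cycle `c` with coefficients in `k[G/T̃]`
(the inverse of the averaging isomorphism on `[c]`). [cite: Brown1982, Ch. III §6] -/
def cosetClass (c : cycles₁ (PermutationCoeff.permRepObj k (redGL p M) (GL (Fin 2) (ZMod p) ⧸ diagTorus (ZMod p)))) :
    PermutationCoeff.H1Invariants k (redGL p M) (diagTorus (ZMod p)) :=
  (PermutationCoeff.invariantsEquivQuot (redGL p M) (diagTorus (ZMod p))).symm (H1π _ c)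

/-- `cosetClass c = ⅟|T̃| · [liftCosetChain c]` in `H₁(Γ₀(M), k[GL₂(ℤ/p)])`. [cite: Brown1982, Ch. III §6] -/
theorem coe_cosetClass (c : cycles₁ (PermutationCoeff.permRepObj k (redGL p M) (GL (Fin 2) (ZMod p) ⧸ diagTorus (ZMod p)))) :
    (cosetClass k p M c : H1carrier k p M) =
      ⅟(Fintype.card (diagTorus (ZMod p)) : k) • H1π (coeff k p M) ⟨liftCosetChain k p M c.1, liftCosetChain_mem_cycles₁ k p M c⟩ := by
  rw [cosetClass, PermutationCoeff.invariantsEquivQuot_symm_apply, H1lift_H1π]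

/-- The averaging isomorphism sends `cosetClass c` back to `[c]`. [cite: Brown1982, Ch. III §6] -/
theorem invariantsEquivQuot_cosetClass
    (c : cycles₁ (PermutationCoeff.permRepObj k (redGL p M) (GL (Fin 2) (ZMod p) ⧸ diagTorus (ZMod p)))) :
    PermutationCoeff.invariantsEquivQuot (redGL p M) (diagTorus (ZMod p)) (cosetClass k p M c) = H1π _ c :=
  LinearEquiv.apply_symm_apply _ _

/-- Every `T̃`-invariant class is a `cosetClass`. [cite: Brown1982, Ch. III §6] -/
theorem exists_cosetClass_eq (z : PermutationCoeff.H1Invariants k (redGL p M) (diagTorus (ZMod p))) :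
    ∃ c, cosetClass k p M c = z := by
  obtain ⟨c, hc⟩ := (ModuleCat.epi_iff_surjective (H1π (PermutationCoeff.permRepObj k (redGL p M)
    (GL (Fin 2) (ZMod p) ⧸ diagTorus (ZMod p))))).1 inferInstance
    (PermutationCoeff.invariantsEquivQuot (redGL p M) (diagTorus (ZMod p)) z)
  exact ⟨c, by rw [cosetClass, hc, LinearEquiv.symm_apply_apply]⟩

/-! ### The dictionary on coset classes: transfer to `Γ_T`, then `δ`-conjugation and period symbols -/

variable (hpM : Nat.Coprime p M)

/-- **The dictionary on a transferred class**: if `[c] = componentMap [w]` for `w ∈ C₁(Γ_T, k)` (e.g. `w = symbolPart c`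
by the transfer of `GroupHomologyPermutationModuleGenerators`), then
`torusInvariantsToCuspidal (cosetClass c) = cuspidalClassMap (H₁(δ-conj) [w])`. [cite: Brown1982, Ch. III §6 Prop. 6.2] -/
theorem torusInvariantsEquiv_cosetClass_of_eq
    (c : cycles₁ (PermutationCoeff.permRepObj k (redGL p M) (GL (Fin 2) (ZMod p) ⧸ diagTorus (ZMod p))))
    (w : groupHomology.H1 (Rep.trivial k (torusLevel p M) k))
    (hw : PermutationCoeff.componentMap k (redGL p M) (((1 : GL (Fin 2) (ZMod p)) : GL (Fin 2) (ZMod p) ⧸ diagTorus (ZMod p))) w = H1π _ c) :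
    torusInvariantsEquiv k p M hpM (cosetClass k p M c) = w := by
  rw [torusInvariantsEquiv, LinearEquiv.trans_apply, invariantsEquivQuot_cosetClass]
  exact (LinearEquiv.symm_apply_eq _).2 hw.symm

omit [Fintype (diagTorus (ZMod p))] [Invertible (Fintype.card (diagTorus (ZMod p)) : k)] in
/-- `H₁(δ-conj)` as `groupHomology.map` (unfolding `torusLevelH1Iso`). [cite: DiamondShurman2005, §1.5] -/
theorem torusLevelH1Iso_hom : (torusLevelH1Iso k p M hpM).hom =
    groupHomology.map (torusLevelEquiv p M hpM) (Rep.ofHom ⟨(LinearEquiv.refl k k : k →ₗ[k] k), fun g => by ext; simp⟩) 1 :=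
  rfl

omit [Fintype (diagTorus (ZMod p))] [Invertible (Fintype.card (diagTorus (ZMod p)) : k)] in
/-- `H₁(δ-conj)` on a generator: `[γ ⊗ a] ↦ [δ⁻¹γδ ⊗ a]`. [cite: DiamondShurman2005, §1.5] -/
theorem torusLevelH1Iso_single (γ : torusLevel p M) (a : k) :
    (torusLevelH1Iso k p M hpM).hom (H1π _ ((cycles₁IsoOfIsTrivial (Rep.trivial k (torusLevel p M) k)).inv (single γ a))) =
      H1π _ ((cycles₁IsoOfIsTrivial (Rep.trivial k (Gamma0 (p ^ 2 * M)) k)).inv (single (torusLevelEquiv p M hpM γ) a)) := by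
  rw [torusLevelH1Iso_hom,
    groupHomology.H1π_comp_map_apply (A := Rep.trivial k (torusLevel p M) k) (B := Rep.trivial k (Gamma0 (p ^ 2 * M)) k)]
  congr 1
  apply Subtype.ext
  rw [coe_mapCycles₁, cycles₁IsoOfIsTrivial_inv_apply, cycles₁IsoOfIsTrivial_inv_apply]
  simp only [ModuleCat.hom_ofHom, LinearMap.coe_comp, Function.comp_apply, lmapDomain_apply, mapDomain_single,
    mapRange.linearMap_apply, mapRange_single]
  rfl

/-- **The full dictionary on a generator of `H₁(Γ_T, k)`**: the invariant class whose Shapiro image is `[γ ⊗ a]` maps to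
`a · ({∞, (δ⁻¹γδ)∞} ⊗ 1) ∈ H(p²M; k)`. [cite: AshStevens1986, §1 (1.3); Knapp1993, Prop. 11.22] -/
theorem torusInvariantsToCuspidal_cosetClass_of_eq_single [NeZero M] [NeZero (p ^ 2 * M)]
    (c : cycles₁ (PermutationCoeff.permRepObj k (redGL p M) (GL (Fin 2) (ZMod p) ⧸ diagTorus (ZMod p))))
    (γ : torusLevel p M) (a : k)
    (hw : PermutationCoeff.componentMap k (redGL p M) (((1 : GL (Fin 2) (ZMod p)) : GL (Fin 2) (ZMod p) ⧸ diagTorus (ZMod p)))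
      (H1π (Rep.trivial k (torusLevel p M) k)
        ((cycles₁IsoOfIsTrivial (Rep.trivial k (torusLevel p M) k)).inv (single γ a))) = H1π _ c) :
    torusInvariantsToCuspidal k p M hpM (cosetClass k p M c) =
      a • Literature.NumberTheory.ModularSymbols.symbol (p ^ 2 * M) k (torusLevelEquiv p M hpM γ : Gamma0 (p ^ 2 * M)) := by
  rw [torusInvariantsToCuspidal, LinearMap.comp_apply, LinearEquiv.coe_coe, torusInvariantsEquivGamma0,
    LinearEquiv.trans_apply, torusInvariantsEquiv_cosetClass_of_eq k p M hpM c _ hw, Iso.toLinearEquiv_apply,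
    torusLevelH1Iso_single]
  exact cuspidalClassMap_single (p ^ 2 * M) k _ a

end FullLevel

end Literature.NumberTheory.ModularSymbols

namespace Literature.NumberTheory.ModularSymbols

namespace FullLevel

open scoped MatrixGroups TensorProduct
open CategoryTheory CongruenceSubgroup groupHomology Finsupp Matrix
open Literature.Algebra.Homology
open Literature.NumberTheory.EllipticCurves.ModularForms

variable (k : Type) [CommRing k] (p M : ℕ) [Fact p.Prime] [Fintype (diagTorus (ZMod p))]

/-! ### The Hecke operator on lifted coset chains -/

/-- Left translation of a coset indicator: `g ⋆ 1_{q} = 1_{gq}`. [cite: Brown1982, Ch. III §5] -/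
theorem coeffAct_cosetIndicator (g : GL (Fin 2) (ZMod p)) (q : GL (Fin 2) (ZMod p) ⧸ diagTorus (ZMod p)) :
    coeffAct k p M g (PermutationCoeff.cosetIndicator (k := k) (redGL p M) (diagTorus (ZMod p)) q) =
      PermutationCoeff.cosetIndicator (k := k) (redGL p M) (diagTorus (ZMod p)) (g • q) := by
  induction q using QuotientGroup.induction_on with
  | H x =>
    rw [MulAction.Quotient.smul_coe, smul_eq_mul, PermutationCoeff.cosetIndicator_coe, PermutationCoeff.cosetIndicator_coe,
      map_sum]
    refine Finset.sum_congr rfl fun h _ => ?_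
    rw [coeffAct_single, mul_assoc]

/-- `g ⋆ σ'(f) = σ'(g ⋆ f)`: the coset lift commutes with left translations by ANY `g ∈ GL₂(ℤ/p)`.
[cite: Brown1982, Ch. III §5] -/
theorem coeffAct_cosetLiftHom (g : GL (Fin 2) (ZMod p))
    (f : PermutationCoeff.permRepObj k (redGL p M) (GL (Fin 2) (ZMod p) ⧸ diagTorus (ZMod p))) :
    coeffAct k p M g ((PermutationCoeff.cosetLiftHom (k := k) (redGL p M) (diagTorus (ZMod p))).hom f) =
      (PermutationCoeff.cosetLiftHom (k := k) (redGL p M) (diagTorus (ZMod p))).hom (Finsupp.lmapDomain k k (g • ·) f) := by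
  induction f using Finsupp.induction_linear with
  | zero => simp
  | add f₁ f₂ h₁ h₂ => rw [map_add, map_add, h₁, h₂, map_add, map_add]
  | single q a =>
    rw [PermutationCoeff.cosetLiftHom_single, map_smul, coeffAct_cosetIndicator, lmapDomain_apply, mapDomain_single,
      PermutationCoeff.cosetLiftHom_single]

variable {q : ℕ} [NeZero q] (hq : q.Prime) (hqp : q ≠ p)

omit [Fintype (diagTorus (ZMod p))] in
/-- The Hecke operator on chains with COSET coefficients `k[G/T̃]`: `[γ] ⊗ f ↦ Σᵢ [γ'ᵢ] ⊗ β̄ᵢ⋆f`.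
[cite: Shimura1971, §8.3 (8.3.2)] -/
def heckeChainQuot : (Gamma0 M →₀ PermutationCoeff.permRepObj k (redGL p M) (GL (Fin 2) (ZMod p) ⧸ diagTorus (ZMod p))) →ₗ[k]
    (Gamma0 M →₀ PermutationCoeff.permRepObj k (redGL p M) (GL (Fin 2) (ZMod p) ⧸ diagTorus (ZMod p))) :=
  Finsupp.lsum k fun γ => ∑ i : HeckeIdx M q,
    (Finsupp.lsingle (heckePermElt hq γ i)).comp (Finsupp.lmapDomain k k (betaBar p M hq hqp i • ·))

omit [Fintype (diagTorus (ZMod p))] in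
/-- Unfolding `heckeChainQuot` on a single. [cite: Shimura1971, §8.3 (8.3.2)] -/
theorem heckeChainQuot_single (γ : Gamma0 M)
    (f : PermutationCoeff.permRepObj k (redGL p M) (GL (Fin 2) (ZMod p) ⧸ diagTorus (ZMod p))) :
    heckeChainQuot k p M hq hqp (single γ f) =
      ∑ i : HeckeIdx M q, Finsupp.single (heckePermElt hq γ i) (Finsupp.lmapDomain k k (betaBar p M hq hqp i • ·) f) := by
  simp only [heckeChainQuot, Finsupp.lsum_single, LinearMap.sum_apply, LinearMap.coe_comp, Function.comp_apply,
    Finsupp.lsingle_apply]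

/-- **`T_q ∘ lift = lift ∘ T_q^{quot}`**: the Hecke operator on `k[G]`-chains of a lifted `k[G/T̃]`-chain is the lift of
the coset-coefficient Hecke operator. [cite: Shimura1971, §8.3 (8.3.2)] -/
theorem heckeChain_liftCosetChain
    (c : Gamma0 M →₀ PermutationCoeff.permRepObj k (redGL p M) (GL (Fin 2) (ZMod p) ⧸ diagTorus (ZMod p))) :
    heckeChain k p M hq hqp (liftCosetChain k p M c) = liftCosetChain k p M (heckeChainQuot k p M hq hqp c) := by
  induction c using Finsupp.induction_linear with
  | zero => simp [liftCosetChain]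
  | add c₁ c₂ h₁ h₂ =>
    simp only [liftCosetChain, map_add] at h₁ h₂ ⊢
    rw [h₁, h₂]
  | single γ f =>
    unfold liftCosetChain
    rw [mapRange.linearMap_apply, mapRange_single, heckeChain_single, heckeChainQuot_single, map_sum]
    refine Finset.sum_congr rfl fun i _ => ?_
    rw [mapRange.linearMap_apply, mapRange_single]
    exact congrArg (Finsupp.single (heckePermElt hq γ i)) (coeffAct_cosetLiftHom k p M _ f)

end FullLevel

end Literature.NumberTheory.ModularSymbols
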